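import Summits.QuantumFields.BalabanUV.Beta.D1BFx.FineStencilBF
import Summits.QuantumFields.BalabanUV.Beta.D1BFx.ReducedTableF
import Literature.MathematicalPhysics.QuantumFieldTheory.Balaban1983to89.Beta.KernelReflection

/-!
# `BalabanUV.Beta.D1BFx.SecondStencilBF` — road «BF-x» for binder row D1, typer object T5-asm: THE GENERIC FIVE-SLOT ASSEMBLY
# `Wbf` OF THE BF SECOND-ORDER FINE STENCIL, its sockets, and the T7/T8 plugs through `tableRedF`

HONEST DEPENDENCY (page 1, standing): continuum YM on `T⁴` ⇐ `BetaPertH` ∧ nine spine estimates (0/9 proved); `BetaPertH` ⇐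
(D1) ∧ (D4) ∧ CAP+tail; G-an2-4 gates asym, D1 and NE2/3/4.  HONEST FRAMING: discharging `BetaPertH` would make Bałaban's
ultraviolet stability UNCONDITIONAL — NOT the continuum limit and NOT the Clay problem.  THIS MODULE is typed bookkeeping for ONE
road (BF-x) to ONE conjunct (D1): DEFINITIONS of our own objects ([our object]) and [folklore] socket lemmas about them; it instantiates
NO binder of (D1), proves NO estimate of node A, contains NO sector CONTENT, and nothing in it is a cited fact.

WHAT IS TYPED (owner's `TYPER-SPEC-D1BFx.md` §1 T5; swarm index `beta/formal/D1/LEAVES.md` §B).  The second-order fine stencil of the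
background-field road is, like the first-order one (`FineStencilBF.Sbf`, T4), a WEIGHTED SUM OF SECTORS — Wilson quartic (E₂), the
J4 weight vertex, and the second jets of the Lagrange piece (J3), of the `R`-term (J5) and of the averaging term (J6) — each a family
`W κ u λ u′ : MKer 4 (Fin 4)` indexed by TWO FINE bonds, i.e. an element of the road currency `ReducedKernel.TableR`.  Exactly as T4
kept the J5 objects as parameters `R`, `Ṙ` until their typed instances existed (then `FineStencilBFBalaban.SbfBal`, binder-free), this
module keeps ALL FIVE SECTORS AS TABLE PARAMETERS `WE WJ WΛ WR WQ : TableR` with real colour weights `cE₂ cJ4 cΛ₂ cR₂ cQ₂`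
(colour-stripping convention of `StepJetData` §5):

  `Wbf cE₂ cJ4 cΛ₂ cR₂ cQ₂ WE WJ WΛ WR WQ κ u λ u′ :=`
  `  cE₂ • WE κ u λ u′ + cJ4 • WJ κ u λ u′ + cΛ₂ • WΛ κ u λ u′ + cR₂ • WR κ u λ u′ + cQ₂ • WQ κ u λ u′`.

Sector status at the time of writing: E₂ = `WilsonQuarticStencil.wq` (swarm leaf 09, gen 3; plugs into `WE` BY NAME once in the tree);
J4 / Λ₂ / R₂ / Q₂ = OPEN sector sub-leaves (the owner's dictionary, TYPER-SPEC §1; rulings pending as for T4's J6 sector).  The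
binder-free instance `WbfBal` is a later one-screen file by a prover seat, as `SbfBal` was for T4.

SOCKETS, in the consumers' binder shapes (all LINEAR in the sectors, hence proved here once):
* §2 `biLoc_Wbf` — two-centre localisation `BiLoc (W κ u λ u′) u u′ C δ` of every sector at a common rate ⇒ the same for `Wbf` with
  the explicit constant `Σ |c|·C` (`KernelWard.biLoc_add`, `StepJetData.biLoc_smul`); `exists_biLoc_Wbf` — the packaged form at the
  minimum of five sector rates (`FineStencilBF.biLoc_anti`).  This is the `hW` of `FineHessianReflection.fineHessA_refl` /
  `FineHessianWard.…_of_laws` (A4-leg) and the `hWf` of `ReducedTableF.vertexFamily₂_tableRedF`.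
* §2 `Wbf_symm` — bond-swap symmetry `W κ u λ u′ = W λ u′ κ u` (A4-leg's `hWsymm`); `Wbf_translate_block` — block covariance in the
  tree's NEGATIVE convention `W κ (u + n•t) λ (u′ + n•t) = shiftK (−(n•t)) (W κ u λ u′)` (A4-leg's `hWcov`, `tableRedF_translate`'s
  hypothesis); `Wbf_refl` — the two-bond relabelling law `W κ (ρ κ u) λ (ρ λ u′) = (σ κ · σ λ) • refK Φ (W κ u λ u′)` (the `hWr` of
  `fineHessA_refl`); `Wbf_transpose` — kernel symmetry `W κ u λ u′ z x b a = W κ u λ u′ x z a b`.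
* §3 THE T7/T8 PLUGS through the typer's `ReducedTableF` (p210460) BY NAME: `exists_vertexFamily₂_tableRedF_Wbf` — the
  `ℋ ⊗ ℋ`-dressed table `tableRedF n (Wbf …)` is a `VertexFamily₂` at blocking `n` (the `hW` of `ReducedKernelF.absMoment₂_TOfLeg`);
  `tableRedF_Wbf_translate` — its block covariance (the `hW` of `ReducedKernelF.blockCovariant_TOfLeg`).

NOT IN THIS MODULE (said plainly): the second-order Ward law (W2) — it is NOT sector-linear (it couples the first-order stencil `S`
through `fineHessA`), so A4-leg takes it as `hrow` on the TOTAL; any sector content; any estimate; the instance `WbfBal`.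

All declarations [our object] (definitions; assert nothing) or [folklore] (linear bookkeeping).  No `sorry`; no `[cite:]` fact used as a
hypothesis; axioms ⊆ {propext, Classical.choice, Quot.sound}.  Provenance: b2b-balaban β sub-cell, D1 formalisation swarm, TYPER gen 2
(`b2b-balaban-beta-d1-formalise-typer`), 2026-08-20; staged for a prover-role courier; over `FineStencilBF` (T4, p212927),
`ReducedTableF` (p210460), `ReducedKernel` (swarm leaf 04) and Literature `KernelReflection` BY NAME; no existing file touched.
-/

noncomputable section

open Literature.MathematicalPhysics.QuantumFieldTheory.Balaban1983to89
open Literature.MathematicalPhysics.QuantumFieldTheory.Balaban1983to89.Beta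
open B12Sec2to5 (l1 l1_nonneg)
open ExpKernelCalculus (Site MKer BiLoc VertexFamily₂ shiftK)
open KernelReflection (LegMap refK refK_apply)
open Summit.QuantumFields.BalabanUV.Beta.D1BFx.ReducedKernel (TableR)
open Summit.QuantumFields.BalabanUV.Beta.D1BFx.ReducedTableF (tableRedF vertexFamily₂_tableRedF' tableRedF_translate)
open Summit.QuantumFields.BalabanUV.Beta.D1BFx.FineStencilBF (biLoc_anti)

namespace Summit.QuantumFields.BalabanUV.Beta.D1BFx.SecondStencilBF

/-! ## §1 The assembly -/

/-- [our object] **THE BF-x SECOND-ORDER FINE STENCIL, GENERIC FIVE-SLOT ASSEMBLY** in the road currency `TableR`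
(two fine bonds `(κ,u)`, `(λ,u′)` ↦ `MKer 4 (Fin 4)`): `cE₂ • WE + cJ4 • WJ + cΛ₂ • WΛ + cR₂ • WR + cQ₂ • WQ` bondwise — the
sectors (Wilson quartic E₂, J4 weight vertex, second jets of J3 / J5 / J6) are TABLE PARAMETERS, the colour weights real
parameters.  A DEFINITION; asserts nothing. -/
def Wbf (cE₂ cJ4 cΛ₂ cR₂ cQ₂ : ℝ) (WE WJ WΛ WR WQ : TableR) : TableR :=
  fun κ u l u' => cE₂ • WE κ u l u' + cJ4 • WJ κ u l u' + cΛ₂ • WΛ κ u l u' + cR₂ • WR κ u l u' + cQ₂ • WQ κ u l u'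

/-- [our object] Unfolding `Wbf` at a bond pair. -/
@[simp] theorem Wbf_apply (cE₂ cJ4 cΛ₂ cR₂ cQ₂ : ℝ) (WE WJ WΛ WR WQ : TableR) (κ : Fin 4) (u : Site 4) (l : Fin 4)
    (u' : Site 4) :
    Wbf cE₂ cJ4 cΛ₂ cR₂ cQ₂ WE WJ WΛ WR WQ κ u l u' =
      cE₂ • WE κ u l u' + cJ4 • WJ κ u l u' + cΛ₂ • WΛ κ u l u' + cR₂ • WR κ u l u' + cQ₂ • WQ κ u l u' := rfl

/-- [our object] The entries of `Wbf`. -/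
theorem Wbf_apply_apply (cE₂ cJ4 cΛ₂ cR₂ cQ₂ : ℝ) (WE WJ WΛ WR WQ : TableR) (κ : Fin 4) (u : Site 4) (l : Fin 4)
    (u' x z : Site 4) (a b : Fin 4) :
    Wbf cE₂ cJ4 cΛ₂ cR₂ cQ₂ WE WJ WΛ WR WQ κ u l u' x z a b =
      cE₂ * WE κ u l u' x z a b + cJ4 * WJ κ u l u' x z a b + cΛ₂ * WΛ κ u l u' x z a b + cR₂ * WR κ u l u' x z a b +
        cQ₂ * WQ κ u l u' x z a b := by
  simp only [Wbf_apply, Pi.add_apply, Pi.smul_apply, smul_eq_mul]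

/-- [our object] A sector with weight `0` drops out (E₂-slot form; the other four slots are symmetric instances of the same
`simp`). -/
theorem Wbf_zero_E (cJ4 cΛ₂ cR₂ cQ₂ : ℝ) (WE WE' WJ WΛ WR WQ : TableR) :
    Wbf 0 cJ4 cΛ₂ cR₂ cQ₂ WE WJ WΛ WR WQ = Wbf 0 cJ4 cΛ₂ cR₂ cQ₂ WE' WJ WΛ WR WQ := by
  funext κ u l u'
  simp only [Wbf_apply, zero_smul]

variable {cE₂ cJ4 cΛ₂ cR₂ cQ₂ : ℝ} {WE WJ WΛ WR WQ : TableR}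

/-! ## §2 The sockets (all linear in the sectors) -/

/-- [folklore] **SOCKET 1 (two-centre localisation), explicit constant**: sectors bi-localised at `(u, u′)` with constants
`CE … CQ` at ONE common rate `δ` ⇒ `BiLoc (Wbf … κ u λ u′) u u′ (|cE₂|·CE + |cJ4|·CJ + |cΛ₂|·CΛ + |cR₂|·CR + |cQ₂|·CQ) δ`
(`KernelWard.biLoc_add`, `StepJetData.biLoc_smul`; match rates first with `FineStencilBF.biLoc_anti`). -/
theorem biLoc_Wbf {CE CJ CΛ CR CQ δ : ℝ} (hE : ∀ κ u l u', BiLoc (WE κ u l u') u u' CE δ)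
    (hJ : ∀ κ u l u', BiLoc (WJ κ u l u') u u' CJ δ) (hΛ : ∀ κ u l u', BiLoc (WΛ κ u l u') u u' CΛ δ)
    (hR : ∀ κ u l u', BiLoc (WR κ u l u') u u' CR δ) (hQ : ∀ κ u l u', BiLoc (WQ κ u l u') u u' CQ δ)
    (κ : Fin 4) (u : Site 4) (l : Fin 4) (u' : Site 4) :
    BiLoc (Wbf cE₂ cJ4 cΛ₂ cR₂ cQ₂ WE WJ WΛ WR WQ κ u l u') u u'
      (|cE₂| * CE + |cJ4| * CJ + |cΛ₂| * CΛ + |cR₂| * CR + |cQ₂| * CQ) δ :=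
  KernelWard.biLoc_add (KernelWard.biLoc_add (KernelWard.biLoc_add (KernelWard.biLoc_add
    (StepJetData.biLoc_smul (hE κ u l u') cE₂) (StepJetData.biLoc_smul (hJ κ u l u') cJ4))
    (StepJetData.biLoc_smul (hΛ κ u l u') cΛ₂)) (StepJetData.biLoc_smul (hR κ u l u') cR₂))
    (StepJetData.biLoc_smul (hQ κ u l u') cQ₂)

/-- [folklore] **SOCKET 1, packaged**: sectors bi-localised at their own positive rates `δE … δQ` ⇒ `Wbf` is bi-localised at
`δ := min δE (min δJ (min δΛ (min δR δQ)))`, `0 < δ`, `δ ≤` each sector rate — the `hW`/`hWf` input of A4-leg and of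
`ReducedTableF.vertexFamily₂_tableRedF`. -/
theorem exists_biLoc_Wbf (cE₂ cJ4 cΛ₂ cR₂ cQ₂ : ℝ) {CE CJ CΛ CR CQ δE δJ δΛ δR δQ : ℝ} (hδE : 0 < δE) (hδJ : 0 < δJ)
    (hδΛ : 0 < δΛ) (hδR : 0 < δR) (hδQ : 0 < δQ) (hE : ∀ κ u l u', BiLoc (WE κ u l u') u u' CE δE)
    (hJ : ∀ κ u l u', BiLoc (WJ κ u l u') u u' CJ δJ) (hΛ : ∀ κ u l u', BiLoc (WΛ κ u l u') u u' CΛ δΛ)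
    (hR : ∀ κ u l u', BiLoc (WR κ u l u') u u' CR δR) (hQ : ∀ κ u l u', BiLoc (WQ κ u l u') u u' CQ δQ) :
    ∃ C δ : ℝ, 0 < δ ∧ δ ≤ δE ∧ δ ≤ δJ ∧ δ ≤ δΛ ∧ δ ≤ δR ∧ δ ≤ δQ ∧
      ∀ κ u l u', BiLoc (Wbf cE₂ cJ4 cΛ₂ cR₂ cQ₂ WE WJ WΛ WR WQ κ u l u') u u' C δ := by
  set δ : ℝ := min δE (min δJ (min δΛ (min δR δQ)))
  have h1 : δ ≤ δE := min_le_left _ _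
  have h2 : δ ≤ δJ := (min_le_right _ _).trans (min_le_left _ _)
  have h3 : δ ≤ δΛ := (min_le_right _ _).trans ((min_le_right _ _).trans (min_le_left _ _))
  have h4 : δ ≤ δR :=
    (min_le_right _ _).trans ((min_le_right _ _).trans ((min_le_right _ _).trans (min_le_left _ _)))
  have h5 : δ ≤ δQ :=
    (min_le_right _ _).trans ((min_le_right _ _).trans ((min_le_right _ _).trans (min_le_right _ _)))
  have hδ : 0 < δ := lt_min hδE (lt_min hδJ (lt_min hδΛ (lt_min hδR hδQ)))
  exact ⟨_, δ, hδ, h1, h2, h3, h4, h5, biLoc_Wbf (fun κ u l u' => biLoc_anti (hE κ u l u') h1)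
    (fun κ u l u' => biLoc_anti (hJ κ u l u') h2) (fun κ u l u' => biLoc_anti (hΛ κ u l u') h3)
    (fun κ u l u' => biLoc_anti (hR κ u l u') h4) (fun κ u l u' => biLoc_anti (hQ κ u l u') h5)⟩

/-- [folklore] **SOCKET 2 (bond-swap symmetry)** — A4-leg's `hWsymm`: symmetric sectors ⇒ `Wbf … κ u λ u′ = Wbf … λ u′ κ u`. -/
theorem Wbf_symm (hE : ∀ κ u l u', WE κ u l u' = WE l u' κ u) (hJ : ∀ κ u l u', WJ κ u l u' = WJ l u' κ u)
    (hΛ : ∀ κ u l u', WΛ κ u l u' = WΛ l u' κ u) (hR : ∀ κ u l u', WR κ u l u' = WR l u' κ u)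
    (hQ : ∀ κ u l u', WQ κ u l u' = WQ l u' κ u) (κ : Fin 4) (u : Site 4) (l : Fin 4) (u' : Site 4) :
    Wbf cE₂ cJ4 cΛ₂ cR₂ cQ₂ WE WJ WΛ WR WQ κ u l u' = Wbf cE₂ cJ4 cΛ₂ cR₂ cQ₂ WE WJ WΛ WR WQ l u' κ u := by
  rw [Wbf_apply, Wbf_apply, hE κ u l u', hJ κ u l u', hΛ κ u l u', hR κ u l u', hQ κ u l u']

/-- [folklore] **SOCKET 3 (block covariance, NEGATIVE convention)** — A4-leg's `hWcov` / the hypothesis of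
`ReducedTableF.tableRedF_translate`: block-covariant sectors ⇒
`Wbf … κ (u + n•t) λ (u′ + n•t) = shiftK (−(n•t)) (Wbf … κ u λ u′)`. -/
theorem Wbf_translate_block {n : ℕ}
    (hE : ∀ (κ : Fin 4) (u : Site 4) (l : Fin 4) (u' t : Site 4),
      WE κ (u + (n : ℤ) • t) l (u' + (n : ℤ) • t) = shiftK (-((n : ℤ) • t)) (WE κ u l u'))
    (hJ : ∀ (κ : Fin 4) (u : Site 4) (l : Fin 4) (u' t : Site 4),
      WJ κ (u + (n : ℤ) • t) l (u' + (n : ℤ) • t) = shiftK (-((n : ℤ) • t)) (WJ κ u l u'))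
    (hΛ : ∀ (κ : Fin 4) (u : Site 4) (l : Fin 4) (u' t : Site 4),
      WΛ κ (u + (n : ℤ) • t) l (u' + (n : ℤ) • t) = shiftK (-((n : ℤ) • t)) (WΛ κ u l u'))
    (hR : ∀ (κ : Fin 4) (u : Site 4) (l : Fin 4) (u' t : Site 4),
      WR κ (u + (n : ℤ) • t) l (u' + (n : ℤ) • t) = shiftK (-((n : ℤ) • t)) (WR κ u l u'))
    (hQ : ∀ (κ : Fin 4) (u : Site 4) (l : Fin 4) (u' t : Site 4),
      WQ κ (u + (n : ℤ) • t) l (u' + (n : ℤ) • t) = shiftK (-((n : ℤ) • t)) (WQ κ u l u'))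
    (κ : Fin 4) (u : Site 4) (l : Fin 4) (u' t : Site 4) :
    Wbf cE₂ cJ4 cΛ₂ cR₂ cQ₂ WE WJ WΛ WR WQ κ (u + (n : ℤ) • t) l (u' + (n : ℤ) • t) =
      shiftK (-((n : ℤ) • t)) (Wbf cE₂ cJ4 cΛ₂ cR₂ cQ₂ WE WJ WΛ WR WQ κ u l u') := by
  funext x z a b
  simp only [Wbf_apply, Pi.add_apply, Pi.smul_apply, hE κ u l u' t, hJ κ u l u' t, hΛ κ u l u' t, hR κ u l u' t,
    hQ κ u l u' t, shiftK]

/-- [folklore] **SOCKET 4 (two-bond relabelling law)** — the `hWr` of `FineHessianReflection.fineHessA_refl`: if every sector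
obeys `W κ (ρ κ u) λ (ρ λ u′) = (σ κ · σ λ) • refK Φ (W κ u λ u′)` for a leg relabelling `Φ`, a bond map `ρ` and bond signs `σ`,
then so does `Wbf` (the law is linear). -/
theorem Wbf_refl (Φ : LegMap 4 (Fin 4)) (ρ : Fin 4 → Site 4 → Site 4) (σ : Fin 4 → ℝ)
    (hE : ∀ κ u l u', WE κ (ρ κ u) l (ρ l u') = (σ κ * σ l) • refK Φ (WE κ u l u'))
    (hJ : ∀ κ u l u', WJ κ (ρ κ u) l (ρ l u') = (σ κ * σ l) • refK Φ (WJ κ u l u'))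
    (hΛ : ∀ κ u l u', WΛ κ (ρ κ u) l (ρ l u') = (σ κ * σ l) • refK Φ (WΛ κ u l u'))
    (hR : ∀ κ u l u', WR κ (ρ κ u) l (ρ l u') = (σ κ * σ l) • refK Φ (WR κ u l u'))
    (hQ : ∀ κ u l u', WQ κ (ρ κ u) l (ρ l u') = (σ κ * σ l) • refK Φ (WQ κ u l u'))
    (κ : Fin 4) (u : Site 4) (l : Fin 4) (u' : Site 4) :
    Wbf cE₂ cJ4 cΛ₂ cR₂ cQ₂ WE WJ WΛ WR WQ κ (ρ κ u) l (ρ l u') =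
      (σ κ * σ l) • refK Φ (Wbf cE₂ cJ4 cΛ₂ cR₂ cQ₂ WE WJ WΛ WR WQ κ u l u') := by
  funext x z a b
  rw [Wbf_apply, hE κ u l u', hJ κ u l u', hΛ κ u l u', hR κ u l u', hQ κ u l u']
  simp only [Pi.add_apply, Pi.smul_apply, smul_eq_mul, refK_apply, Wbf_apply]
  ring

/-- [folklore] **SOCKET 5 (kernel symmetry)**: sectors symmetric as bilinear forms, `W κ u λ u′ z x b a = W κ u λ u′ x z a b`,
⇒ the same for `Wbf`. -/
theorem Wbf_transpose (hE : ∀ (κ : Fin 4) (u : Site 4) (l : Fin 4) (u' x z : Site 4) (a b : Fin 4),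
      WE κ u l u' z x b a = WE κ u l u' x z a b)
    (hJ : ∀ (κ : Fin 4) (u : Site 4) (l : Fin 4) (u' x z : Site 4) (a b : Fin 4), WJ κ u l u' z x b a = WJ κ u l u' x z a b)
    (hΛ : ∀ (κ : Fin 4) (u : Site 4) (l : Fin 4) (u' x z : Site 4) (a b : Fin 4), WΛ κ u l u' z x b a = WΛ κ u l u' x z a b)
    (hR : ∀ (κ : Fin 4) (u : Site 4) (l : Fin 4) (u' x z : Site 4) (a b : Fin 4), WR κ u l u' z x b a = WR κ u l u' x z a b)
    (hQ : ∀ (κ : Fin 4) (u : Site 4) (l : Fin 4) (u' x z : Site 4) (a b : Fin 4), WQ κ u l u' z x b a = WQ κ u l u' x z a b)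
    (κ : Fin 4) (u : Site 4) (l : Fin 4) (u' x z : Site 4) (a b : Fin 4) :
    Wbf cE₂ cJ4 cΛ₂ cR₂ cQ₂ WE WJ WΛ WR WQ κ u l u' z x b a = Wbf cE₂ cJ4 cΛ₂ cR₂ cQ₂ WE WJ WΛ WR WQ κ u l u' x z a b := by
  rw [Wbf_apply_apply, Wbf_apply_apply, hE, hJ, hΛ, hR, hQ]

/-! ## §3 The T7/T8 plugs: the `ℋ ⊗ ℋ`-dressed table of `Wbf` -/

section Plugs

variable (n : ℕ) [NeZero n]

/-- [folklore] **T7/T8 PLUG 1** — the `hW : VertexFamily₂ W n Cw δ2` input of `ReducedKernelF.absMoment₂_TOfLeg` for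
`W := tableRedF n (Wbf …)`: sectors bi-localised at positive rates ⇒ `∃ Cw δ2, 0 < δ2 ∧ VertexFamily₂ (tableRedF n (Wbf …)) n Cw δ2`
(`exists_biLoc_Wbf` + the typer's `ReducedTableF.vertexFamily₂_tableRedF'` BY NAME). -/
theorem exists_vertexFamily₂_tableRedF_Wbf (cE₂ cJ4 cΛ₂ cR₂ cQ₂ : ℝ) {CE CJ CΛ CR CQ δE δJ δΛ δR δQ : ℝ}
    (hδE : 0 < δE) (hδJ : 0 < δJ) (hδΛ : 0 < δΛ) (hδR : 0 < δR) (hδQ : 0 < δQ)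
    (hE : ∀ κ u l u', BiLoc (WE κ u l u') u u' CE δE) (hJ : ∀ κ u l u', BiLoc (WJ κ u l u') u u' CJ δJ)
    (hΛ : ∀ κ u l u', BiLoc (WΛ κ u l u') u u' CΛ δΛ) (hR : ∀ κ u l u', BiLoc (WR κ u l u') u u' CR δR)
    (hQ : ∀ κ u l u', BiLoc (WQ κ u l u') u u' CQ δQ) :
    ∃ Cw δ2 : ℝ, 0 < δ2 ∧ VertexFamily₂ (tableRedF n (Wbf cE₂ cJ4 cΛ₂ cR₂ cQ₂ WE WJ WΛ WR WQ)) n Cw δ2 := by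
  obtain ⟨C, δ, hδ, -, -, -, -, -, hW⟩ := exists_biLoc_Wbf cE₂ cJ4 cΛ₂ cR₂ cQ₂ hδE hδJ hδΛ hδR hδQ hE hJ hΛ hR hQ
  obtain ⟨Cw, δ2, hδ2, -, hV⟩ := vertexFamily₂_tableRedF' n hW hδ
  exact ⟨Cw, δ2, hδ2, hV⟩

/-- [folklore] **T7/T8 PLUG 2** — the `hW` of `ReducedKernelF.blockCovariant_TOfLeg` for `W := tableRedF n (Wbf …)`: block-covariant
sectors ⇒ `tableRedF n (Wbf …) μ (y + t) ν (y′ + t) = shiftK (−(n•t)) (tableRedF n (Wbf …) μ y ν y′)`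
(`Wbf_translate_block` + `ReducedTableF.tableRedF_translate` BY NAME). -/
theorem tableRedF_Wbf_translate
    (hE : ∀ (κ : Fin 4) (u : Site 4) (l : Fin 4) (u' t : Site 4),
      WE κ (u + (n : ℤ) • t) l (u' + (n : ℤ) • t) = shiftK (-((n : ℤ) • t)) (WE κ u l u'))
    (hJ : ∀ (κ : Fin 4) (u : Site 4) (l : Fin 4) (u' t : Site 4),
      WJ κ (u + (n : ℤ) • t) l (u' + (n : ℤ) • t) = shiftK (-((n : ℤ) • t)) (WJ κ u l u'))
    (hΛ : ∀ (κ : Fin 4) (u : Site 4) (l : Fin 4) (u' t : Site 4),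
      WΛ κ (u + (n : ℤ) • t) l (u' + (n : ℤ) • t) = shiftK (-((n : ℤ) • t)) (WΛ κ u l u'))
    (hR : ∀ (κ : Fin 4) (u : Site 4) (l : Fin 4) (u' t : Site 4),
      WR κ (u + (n : ℤ) • t) l (u' + (n : ℤ) • t) = shiftK (-((n : ℤ) • t)) (WR κ u l u'))
    (hQ : ∀ (κ : Fin 4) (u : Site 4) (l : Fin 4) (u' t : Site 4),
      WQ κ (u + (n : ℤ) • t) l (u' + (n : ℤ) • t) = shiftK (-((n : ℤ) • t)) (WQ κ u l u'))
    (μ : Fin 4) (y : Site 4) (ν : Fin 4) (y' t : Site 4) :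
    tableRedF n (Wbf cE₂ cJ4 cΛ₂ cR₂ cQ₂ WE WJ WΛ WR WQ) μ (y + t) ν (y' + t) =
      shiftK (-((n : ℤ) • t)) (tableRedF n (Wbf cE₂ cJ4 cΛ₂ cR₂ cQ₂ WE WJ WΛ WR WQ) μ y ν y') :=
  tableRedF_translate n (fun κ u l u' t' => Wbf_translate_block hE hJ hΛ hR hQ κ u l u' t') μ y ν y' t

end Plugs

end Summit.QuantumFields.BalabanUV.Beta.D1BFx.SecondStencilBF

end
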